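import Summits.QuantumFields.BalabanUV.T4Continuum.Spine.NE1p.B7AveragingIterateCommutatorBound

/-!
# T⁴ programme, spine estimate NE1′ (node O3b/H2) — the quadratic term of the printed average (42) at a PURE-GAUGE
# background `1^u`: conjugate of the flat term of the TRANSPORTED field, hence the same structure and size

Cell `pub-balaban-gaps` (YM blitz Y1, track G2), seat `ne1` gen 10 (prover-pub-balaban-gaps-ne1-g10-0); record `HOME/ne/NE1.md`
v10 R61 (the S-sized warm-up of door (c): backgrounds `U₀ = 1^u`, before curved ones).  ADDITIVE — imports this seat's
`B7AveragingIterateCommutatorBound` (gen 10) and through it files 7–11, gen 8's `B7AveragingAbelianSector` and the lineages'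
`B7Prop1Explicit` ((8) `gaugeAct`, (45) `bavg_gaugeAct`, (23) `mlog_units_conj`, `U1`), `B7Eq14LinearAverage`
(`hasDerivAt_Wcx_expCfg`, `hasDerivAt_bavg_expCfg`), `B8Ineq130` (`Wcx_one`, `bavg_one`) BY NAME; 0 def.  The value algebra
carries `[NormOneClass 𝔸]` here (the lineage's unit-ball subgroup `U1`).

WHAT THIS FILE PROVES ([folklore] bookkeeping on the printed objects; 0 sorry).  `u : ℤᵈ → 𝔸ˣ` a gauge with `u(x), u(x)⁻¹` in
the unit ball, `1^u` the pure-gauge (flat) background `u(x)u(x+e_μ)⁻¹` ((8)), `A` a bond field and `A′` its TRANSPORT to the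
frame `u`, `A(b) = u(b₋)A′(b)u(b₋)⁻¹`:
* `expCfg_smul_mul_pureGauge` — `e^{tA}·1^u = (e^{tA′})^u` exactly ((8) and `exp(uXu⁻¹) = u·exp X·u⁻¹`);
* `eventually_norm_Wcx_expCfg_sub_one_lt` ∕ `eventually_norm_bavg_expCfg_sub_one_lt` — near `t = 0` the loops and the
  averages of `e^{tA′}` stay inside the radius of (21) (continuity; no size hypothesis on `A′`);
* **`eventually_mlog_bavg_pureGauge_ratio` — near `t = 0`, `log( Ū_c(e^{tA}·1^u) · Ū_c(1^u)⁻¹ ) = u(c₋) · log Ū_c(e^{tA′}) ·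
  u(c₋)⁻¹`** ((45) = `bavg_gaugeAct` twice + (23));
* **`iteratedDeriv_two_mlog_bavg_pureGauge` — the quadratic term of the COVARIANT logarithm at the background `1^u` is the
  conjugate of the flat quadratic term of the transported field**: `d²/dt²|₀ log(Ū_c(e^{tA}1^u)Ū_c(1^u)⁻¹) =
  u(c₋)·[d²/dt²|₀ log Ū_c(e^{tA′})]·u(c₋)⁻¹`; hence (file 11) it lies in the span of the pairwise commutators of the values of
  `A′`, VANISHES when those commute (`…_of_commute` — every one-parameter slot: gen 8's file 5 statement, now for `Ū` itself
  rather than for Proposition 4's remainder), and (file 12) obeys **`‖·‖ ≤ ((2d+3)L)²·m′`** with `m′` the largest pairwise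
  commutator of the TRANSPORTED field (`norm_iteratedDeriv_two_mlog_bavg_pureGauge_le`) — the gauge-invariant form of the
  level-1 bound.  (For a non-constant `u` the commutators of `A′`, not of `A`, are the invariant quantity.)
What it does NOT do: CURVED backgrounds (door (c) proper, NE1.md R61), higher levels at a background, RG densities.

HONEST FRAMING.  [folklore] bookkeeping; nothing of Bałaban's asserted; NE1′ NOT proved; spine 0∕9; (B) 0∕13; binders 0∕6; one
fixed finite T⁴ — NOT ℝ⁴, NOT infinite volume, NOT a mass gap, NOT Clay.
-/

noncomputable section

open scoped Topology
open NormedSpace Filter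

namespace Summit.QuantumFields.BalabanUV.T4Continuum.NE1p.B7AveragingCommutator

open Literature.MathematicalPhysics.QuantumFieldTheory.Balaban1983to89.MatrixLog (mlog mlog_one)
open Literature.MathematicalPhysics.QuantumFieldTheory.Balaban1983to89.B7Prop1Explicit
open Literature.MathematicalPhysics.QuantumFieldTheory.Balaban1983to89.B7Prop3Flat (expCfg)
open Literature.MathematicalPhysics.QuantumFieldTheory.Balaban1983to89.B7Prop3GeneralRotated (expCfg_zero)
open Literature.MathematicalPhysics.QuantumFieldTheory.Balaban1983to89.B7Eq14LinearAverage (hasDerivAt_Wcx_expCfg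
  hasDerivAt_bavg_expCfg)
open Literature.MathematicalPhysics.QuantumFieldTheory.Balaban1983to89.B8Ineq130 (hol_one Wcx_one bavg_one)

variable {𝔸 : Type*} [NormedRing 𝔸] [NormOneClass 𝔸] [NormedAlgebra ℂ 𝔸] [CompleteSpace 𝔸]

omit [NormOneClass 𝔸] [CompleteSpace 𝔸] in
/-- The second derivative at `0` from LOCAL derivative data: `f′ = F` near `0` and `F′(0) = w` give `iteratedDeriv 2 f 0 = w`.
[folklore] -/
theorem iteratedDeriv_two_eq_of_derivData {f F : ℂ → 𝔸} {w : 𝔸} (hf : ∀ᶠ t in 𝓝 (0 : ℂ), HasDerivAt f (F t) t)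
    (hF : HasDerivAt F w 0) : iteratedDeriv 2 f 0 = w := by
  have hder : deriv f =ᶠ[𝓝 0] F := hf.mono fun t ht => ht.deriv
  have e2 : iteratedDeriv 2 f = deriv (deriv f) := by rw [iteratedDeriv_eq_iterate]; rfl
  rw [e2, hder.deriv_eq, hF.deriv]

omit [NormOneClass 𝔸] [CompleteSpace 𝔸] in
/-- Conjugation by a unit passes through the second derivative at `0` (local data conjugated termwise). [folklore] -/
theorem iteratedDeriv_two_units_conj {f F : ℂ → 𝔸} {w : 𝔸} (v : 𝔸ˣ) (hf : ∀ᶠ t in 𝓝 (0 : ℂ), HasDerivAt f (F t) t)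
    (hF : HasDerivAt F w 0) :
    iteratedDeriv 2 (fun t : ℂ => (v : 𝔸) * f t * ((v⁻¹ : 𝔸ˣ) : 𝔸)) 0 = (v : 𝔸) * iteratedDeriv 2 f 0 * ((v⁻¹ : 𝔸ˣ) : 𝔸) := by
  rw [iteratedDeriv_two_eq_of_derivData hf hF,
    iteratedDeriv_two_eq_of_derivData (F := fun t => (v : 𝔸) * F t * ((v⁻¹ : 𝔸ˣ) : 𝔸))
      (hf.mono fun t ht => (ht.const_mul _).mul_const _) ((hF.const_mul _).mul_const _)]

section PureGauge

variable {d : ℕ} (L : ℕ) {u : Site d → 𝔸ˣ} (hu : ∀ x, u x ∈ U1 𝔸) {A A' : Site d → Fin d → 𝔸}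
  (hAA' : ∀ (x : Site d) (μ : Fin d), A x μ = (u x : 𝔸) * A' x μ * (((u x)⁻¹ : 𝔸ˣ) : 𝔸))

include hAA' in
omit [NormOneClass 𝔸] in
/-- **`e^{tA}·1^u = (e^{tA′})^u`**: a one-parameter perturbation of the pure-gauge background `1^u` ((8): `1^u(x,μ) =
u(x)u(x+e_μ)⁻¹`) IS the gauge transform of the perturbation `e^{tA′}` of the trivial background by the TRANSPORTED field
`A′ = u⁻¹Au` (`exp(u X u⁻¹) = u·exp X·u⁻¹`, Mathlib `exp_units_conj`). [cite: Balaban1985Averaging, (8) p.18, (11) p.18] -/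
theorem expCfg_smul_mul_pureGauge (t : ℂ) :
    expCfg (t • A) * gaugeAct u 1 = gaugeAct u (expCfg (t • A')) := by
  letI : NormedAlgebra ℚ 𝔸 := NormedAlgebra.restrictScalars ℚ ℂ 𝔸
  funext x μ
  apply Units.ext
  have e1 : t • A x μ = (u x : 𝔸) * (t • A' x μ) * (((u x)⁻¹ : 𝔸ˣ) : 𝔸) := by
    rw [hAA', mul_smul_comm, smul_mul_assoc]
  show exp ((t • A) x μ) * ((u x * (1 : Site d → Fin d → 𝔸ˣ) x μ * (u (x + e μ))⁻¹ : 𝔸ˣ) : 𝔸)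
    = ((u x * expUnit ((t • A') x μ) * (u (x + e μ))⁻¹ : 𝔸ˣ) : 𝔸)
  simp only [Pi.smul_apply]
  rw [e1, exp_units_conj]
  simp only [Pi.one_apply, mul_one, Units.val_mul, val_expUnit, mul_assoc, Units.inv_mul_cancel_left]

omit [NormOneClass 𝔸] hu in
/-- Near `t = 0` every loop variable `e^{tA′}(Γ_{c,x} ∪ (−Γ_c))` of the block stays inside the radius of (21) (continuity at
`0`, where it is `1`; finitely many loops). [cite: Balaban1985Averaging, (21) p.21, (42) p.23] -/
theorem eventually_norm_Wcx_expCfg_sub_one_lt (B : Site d → Fin d → 𝔸) (q : Site d) (κ : Fin d) :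
    ∀ᶠ t in 𝓝 (0 : ℂ), ∀ r : Fin d → Fin L, ‖((Wcx L (expCfg (t • B)) q κ (boxVec L r) : 𝔸ˣ) : 𝔸) - 1‖ < 1 := by
  refine Filter.eventually_all.2 fun r => ?_
  have hc : ContinuousAt (fun t : ℂ => ((Wcx L (expCfg (t • B)) q κ (boxVec L r) : 𝔸ˣ) : 𝔸)) 0 :=
    (hasDerivAt_Wcx_expCfg L B q κ (boxVec L r)).continuousAt
  have h0 : ((Wcx L (expCfg ((0 : ℂ) • B)) q κ (boxVec L r) : 𝔸ˣ) : 𝔸) = 1 := by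
    rw [zero_smul, expCfg_zero, Wcx_one, Units.val_one]
  have hmem : Metric.ball (1 : 𝔸) 1 ∈ 𝓝 (((Wcx L (expCfg ((0 : ℂ) • B)) q κ (boxVec L r) : 𝔸ˣ) : 𝔸)) := by
    rw [h0]; exact Metric.ball_mem_nhds (1 : 𝔸) one_pos
  filter_upwards [hc.eventually_mem hmem] with t ht
  simpa [dist_eq_norm] using Metric.mem_ball.1 ht

omit [NormOneClass 𝔸] hu in
/-- Near `t = 0` the averaged bond `Ū_c(e^{tA′})` stays inside the radius of (21) (`L ≥ 1`). [cite: Balaban1985Averaging, (21) p.21, (42) p.23] -/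
theorem eventually_norm_bavg_expCfg_sub_one_lt (hL : 1 ≤ L) (B : Site d → Fin d → 𝔸) (q : Site d) (κ : Fin d) :
    ∀ᶠ t in 𝓝 (0 : ℂ), ‖((bavg L (expCfg (t • B)) q κ : 𝔸ˣ) : 𝔸) - 1‖ < 1 := by
  have hc : ContinuousAt (fun t : ℂ => ((bavg L (expCfg (t • B)) q κ : 𝔸ˣ) : 𝔸)) 0 :=
    (hasDerivAt_bavg_expCfg L hL B q κ).continuousAt
  have h0 : ((bavg L (expCfg ((0 : ℂ) • B)) q κ : 𝔸ˣ) : 𝔸) = 1 := by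
    rw [zero_smul, expCfg_zero, bavg_one, Units.val_one]
  have hmem : Metric.ball (1 : 𝔸) 1 ∈ 𝓝 (((bavg L (expCfg ((0 : ℂ) • B)) q κ : 𝔸ˣ) : 𝔸)) := by
    rw [h0]; exact Metric.ball_mem_nhds (1 : 𝔸) one_pos
  filter_upwards [hc.eventually_mem hmem] with t ht
  simpa [dist_eq_norm] using Metric.mem_ball.1 ht

include hu hAA'

/-- **(45) at a pure-gauge background, as units**: near `t = 0`,
`Ū_c(e^{tA}·1^u) · Ū_c(1^u)⁻¹ = u(c₋) · Ū_c(e^{tA′}) · u(c₋)⁻¹` (`bavg_gaugeAct` for `e^{tA′}` — inside the radius — and for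
`1`). [cite: Balaban1985Averaging, (45) p.24, (8) p.18] -/
theorem eventually_bavg_pureGauge_ratio (q : Site d) (κ : Fin d) :
    ∀ᶠ t in 𝓝 (0 : ℂ), bavg L (expCfg (t • A) * gaugeAct u 1) q κ * (bavg L (gaugeAct u 1) q κ)⁻¹
      = u q * bavg L (expCfg (t • A')) q κ * (u q)⁻¹ := by
  have h1W : ∀ r : Fin d → Fin L, ‖((Wcx L (1 : Site d → Fin d → 𝔸ˣ) q κ (boxVec L r) : 𝔸ˣ) : 𝔸) - 1‖ < 1 := by
    intro r; rw [Wcx_one, Units.val_one, sub_self, norm_zero]; exact one_pos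
  filter_upwards [eventually_norm_Wcx_expCfg_sub_one_lt L A' q κ] with t hW
  rw [expCfg_smul_mul_pureGauge hAA', bavg_gaugeAct L hu _ q κ hW, bavg_gaugeAct L hu _ q κ h1W, bavg_one]
  group

/-- **The covariant logarithm at a pure-gauge background is the conjugated flat logarithm of the transported field**: near
`t = 0`, `log( Ū_c(e^{tA}·1^u) · Ū_c(1^u)⁻¹ ) = u(c₋) · log Ū_c(e^{tA′}) · u(c₋)⁻¹` ((23): `log(uXu⁻¹) = u·log X·u⁻¹` inside
the radius). [cite: Balaban1985Averaging, (23) p.21, (45) p.24] -/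
theorem eventually_mlog_bavg_pureGauge_ratio (hL : 1 ≤ L) (q : Site d) (κ : Fin d) :
    ∀ᶠ t in 𝓝 (0 : ℂ),
      mlog (((bavg L (expCfg (t • A) * gaugeAct u 1) q κ * (bavg L (gaugeAct u 1) q κ)⁻¹ : 𝔸ˣ) : 𝔸))
        = (u q : 𝔸) * mlog ((bavg L (expCfg (t • A')) q κ : 𝔸ˣ) : 𝔸) * (((u q)⁻¹ : 𝔸ˣ) : 𝔸) := by
  filter_upwards [eventually_bavg_pureGauge_ratio L hu hAA' q κ, eventually_norm_bavg_expCfg_sub_one_lt L hL A' q κ]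
    with t ht hB
  rw [ht, Units.val_mul, Units.val_mul, mlog_units_conj (hu q) hB]

/-- **THE QUADRATIC TERM AT A PURE-GAUGE BACKGROUND IS THE CONJUGATE OF THE FLAT QUADRATIC TERM OF THE TRANSPORTED FIELD**:
`d²/dt²|₀ log( Ū_c(e^{tA}·1^u) · Ū_c(1^u)⁻¹ ) = u(c₋) · [d²/dt²|₀ log Ū_c(e^{tA′})] · u(c₋)⁻¹`, `A = uA′u⁻¹` — so everything
files 8 ∕ 11 ∕ 12 say about the flat term of `A′` transfers: it is an average of ordered pairwise commutators of the values of
`A′`, lies in their span, and is bounded by `((2d+3)L)²·m′`. [cite: Balaban1985Averaging, (15) p.19, (42) p.23, (45) p.24] -/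
theorem iteratedDeriv_two_mlog_bavg_pureGauge (hL : 1 ≤ L) (q : Site d) (κ : Fin d) :
    iteratedDeriv 2 (fun t : ℂ =>
        mlog (((bavg L (expCfg (t • A) * gaugeAct u 1) q κ * (bavg L (gaugeAct u 1) q κ)⁻¹ : 𝔸ˣ) : 𝔸))) 0
      = (u q : 𝔸) * iteratedDeriv 2 (fun t : ℂ => mlog ((bavg L (expCfg (t • A')) q κ : 𝔸ˣ) : 𝔸)) 0
          * (((u q)⁻¹ : 𝔸ˣ) : 𝔸) := by
  rw [Filter.EventuallyEq.iteratedDeriv_eq 2 (eventually_mlog_bavg_pureGauge_ratio L hu hAA' hL q κ)]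
  have h0 : (fun t : ℂ => expCfg (t • A')) 0 = 1 := by simp only [zero_smul, expCfg_zero]
  obtain ⟨Φ₁, Φ₂, hΦ, hΦ₁, -⟩ := exists_derivData_bavg_curve_loc (V := fun t : ℂ => expCfg (t • A')) h0
    (exists_derivData_expCfg_smul A') L q κ
  obtain ⟨hF, hF', -⟩ := derivData_mlog_comp (val_bavg_curve_zero (V := fun t : ℂ => expCfg (t • A')) h0 L q κ) hΦ hΦ₁
  exact iteratedDeriv_two_units_conj (u q) hF hF'

/-- **NO DIAGONAL CURVATURE AT PURE-GAUGE BACKGROUNDS along slots whose TRANSPORTED values commute** (every one-parameter slot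
`A = s·X·δ_b`, in particular): `d²/dt²|₀ log( Ū_c(e^{tA}·1^u) · Ū_c(1^u)⁻¹ ) = 0` — gen 8's file-5 statement
(`CCovIter_pureGauge_eq_zero`, for Proposition 4's remainder) now for the printed average `Ū` itself, with NO radius
hypothesis. [cite: Balaban1985Averaging, (15) p.19, (45) p.24] -/
theorem iteratedDeriv_two_mlog_bavg_pureGauge_of_commute (hL : 1 ≤ L)
    (hA' : ∀ (x : Site d) (κ : Fin d) (y : Site d) (μ : Fin d), Commute (A' x κ) (A' y μ)) (q : Site d) (κ : Fin d) :
    iteratedDeriv 2 (fun t : ℂ =>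
        mlog (((bavg L (expCfg (t • A) * gaugeAct u 1) q κ * (bavg L (gaugeAct u 1) q κ)⁻¹ : 𝔸ˣ) : 𝔸))) 0 = 0 := by
  rw [iteratedDeriv_two_mlog_bavg_pureGauge L hu hAA' hL, iteratedDeriv_two_mlog_bavg_expCfg_of_commute L hA' q κ,
    mul_zero, zero_mul]

/-- **THE LEVEL-1 SIZE BOUND AT A PURE-GAUGE BACKGROUND, GAUGE-INVARIANT FORM**: with `m′ ≥ ‖A′(b)A′(b′) − A′(b′)A′(b)‖` for all
bond pairs of the TRANSPORTED field, `‖d²/dt²|₀ log( Ū_c(e^{tA}·1^u) · Ū_c(1^u)⁻¹ )‖ ≤ ((2d+3)L)²·m′` (file 12's bound for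
`A′`; conjugation by `u(c₋) ∈ U1` does not increase norms).  For non-constant `u` the commutators of `A′` — the values of `A`
compared in the frame `u` — are the invariant quantity, not those of `A`. [cite: Balaban1985Averaging, (15) p.19, (45) p.24] -/
theorem norm_iteratedDeriv_two_mlog_bavg_pureGauge_le (hL : 1 ≤ L) {M : ℝ}
    (hA' : ∀ (x : Site d) (κ : Fin d) (y : Site d) (μ : Fin d), ‖A' x κ * A' y μ - A' y μ * A' x κ‖ ≤ M) (hM : 0 ≤ M)
    (q : Site d) (κ : Fin d) :
    ‖iteratedDeriv 2 (fun t : ℂ =>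
        mlog (((bavg L (expCfg (t • A) * gaugeAct u 1) q κ * (bavg L (gaugeAct u 1) q κ)⁻¹ : 𝔸ˣ) : 𝔸))) 0‖
      ≤ ((2 * d + 3) * L) ^ 2 * M := by
  rw [iteratedDeriv_two_mlog_bavg_pureGauge L hu hAA' hL]
  have hk := norm_iteratedDeriv_two_mlog_bavg_expCfg_le hA' hM L hL q κ
  have hk0 : 0 ≤ ‖iteratedDeriv 2 (fun t : ℂ => mlog ((bavg L (expCfg (t • A')) q κ : 𝔸ˣ) : 𝔸)) 0‖ := norm_nonneg _
  calc _ ≤ ‖(u q : 𝔸) * iteratedDeriv 2 (fun t : ℂ => mlog ((bavg L (expCfg (t • A')) q κ : 𝔸ˣ) : 𝔸)) 0‖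
          * ‖(((u q)⁻¹ : 𝔸ˣ) : 𝔸)‖ := norm_mul_le _ _
    _ ≤ (‖(u q : 𝔸)‖ * ‖iteratedDeriv 2 (fun t : ℂ => mlog ((bavg L (expCfg (t • A')) q κ : 𝔸ˣ) : 𝔸)) 0‖) * 1 :=
        mul_le_mul (norm_mul_le _ _) (hu q).2 (norm_nonneg _) (by positivity)
    _ ≤ (1 * (((2 * d + 3) * L) ^ 2 * M)) * 1 :=
        mul_le_mul_of_nonneg_right (mul_le_mul (hu q).1 hk hk0 zero_le_one) zero_le_one
    _ = ((2 * d + 3) * L) ^ 2 * M := by ring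

end PureGauge

end Summit.QuantumFields.BalabanUV.T4Continuum.NE1p.B7AveragingCommutator

end
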